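import Summits.Ventures.DiscreteObjects.PP12.FixedStructureCounts

/-!
# PP(12): no collineation of order 7 — FAMILY-B1P Lemma 3, fully kernel-checked
Framing: lottery ticket; floor = certified bounds/negative ranges.

**Theorem (`onPoints_eq_one_of_pow_seven`).** A collineation `σ` of a projective plane of order 12 (Mathlib
`Configuration.ProjectivePlane`) with `σ⁷ = 1` on points is the identity. Hence (`no_collineation_of_order_seven`)
no collineation of a projective plane of order 12 has order 7 on points — the `p = 7` case of Janko–van Trung's
theorem that the full collineation group of a plane of order 12 is a `{2,3}`-group (Geom. Dedicata 12 (1982)),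
re-derived here without computation (cell pub-namedobj, target M, family B1-p).

Proof: by `FixedStructureCounts`, a non-trivial such `σ` fixes exactly 31 points, 6 on each fixed line and 6 fixed
lines through each fixed point. Take a fixed line `l` and a non-fixed point `X ∈ l` (13 > 6 points). The 25 fixed
points off `l` lie on pairwise distinct lines through `X` (two of them on one line through `X` would make that
line fixed and `X`, on two fixed lines, fixed) — but only 13 lines pass through `X`. (This is the first half of
Bruck's subplane bound, `n ≥ m²`, specialised to the fixed subplane of order 5.)
-/

namespace Summit.Ventures.DiscreteObjects.PP12

open Configuration Finset

namespace Collineation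

variable {P L : Type*} [Membership P L] [ProjectivePlane P L] [Fintype P] [Fintype L]
  [DecidableEq P] [DecidableEq L] (σ : Collineation P L)

/-- **No collineation of order 7 on a projective plane of order 12**: `σ⁷ = 1` on points forces `σ = 1`. -/
theorem onPoints_eq_one_of_pow_seven (h12 : ProjectivePlane.order P L = 12) (hq : σ.onPoints ^ 7 = 1) :
    σ.onPoints = 1 := by
  classical
  by_contra hne
  haveI : Fact (Nat.Prime 7) := ⟨by norm_num⟩
  -- fixed points S (31 of them) and a fixed point p
  set S : Finset P := univ.filter fun x => σ.onPoints x = x with hS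
  have hS31 : S.card = 31 := σ.fixedCard_eq_31_q7 h12 hne hq
  obtain ⟨p, hpS⟩ := Finset.card_pos.mp (by rw [hS31]; norm_num)
  have hp : σ.onPoints p = p := by simpa [hS] using hpS
  -- a fixed line l through p
  set T : Finset L := univ.filter fun m : L => p ∈ m ∧ σ.onLines m = m with hT
  have hT6 : T.card = 6 := σ.fixedThrough_eq_six_q7 h12 hne hq hp
  obtain ⟨l, hlT⟩ := Finset.card_pos.mp (by rw [hT6]; norm_num)
  have hl : σ.onLines l = l := by simp [hT] at hlT; exact hlT.2
  -- fixed points on l: 6 of the 13 points of l, so some X ∈ l is not fixed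
  have hl6 : σ.fixedOnLine l = 6 := σ.fixedOnLine_eq_six_q7 h12 hne hq hl
  have hlpts : (univ.filter fun x : P => x ∈ l).card = 13 := by
    rw [← Fintype.card_subtype, ← Nat.card_eq_fintype_card]
    change pointCount P l = 13
    rw [ProjectivePlane.pointCount_eq P l, h12]
  obtain ⟨X, hXl, hXnot⟩ : ∃ X : P, X ∈ l ∧ σ.onPoints X ≠ X := by
    by_contra h
    push Not at h
    have hsub : (univ.filter fun x : P => x ∈ l) ⊆ univ.filter fun x => x ∈ l ∧ σ.onPoints x = x :=
      fun x hx => by simp only [mem_filter, mem_univ, true_and] at hx ⊢; exact ⟨hx, h x hx⟩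
    have := Finset.card_le_card hsub
    unfold fixedOnLine at hl6
    rw [hl6, hlpts] at this
    omega
  -- fixed points off l: 25 of them
  set Soff : Finset P := S.filter fun x => x ∉ l with hSoff
  have hSon : (S.filter fun x => x ∈ l).card = 6 := by
    unfold fixedOnLine at hl6
    rw [← hl6]
    congr 1; ext x; simp [hS, and_comm]
  have hSoff25 : Soff.card = 25 := by
    have := Finset.card_filter_add_card_filter_not (s := S) (fun x : P => x ∈ l)
    rw [hSon, hS31] at this
    simpa [hSoff] using (by omega : (S.filter fun x => x ∉ l).card = 25)
  -- lines through X: 13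
  set LX : Finset L := univ.filter fun m : L => X ∈ m with hLX
  have hLX13 : LX.card = 13 := by
    rw [hLX, ← Fintype.card_subtype, ← Nat.card_eq_fintype_card]
    change lineCount L X = 13
    rw [ProjectivePlane.lineCount_eq L X, h12]
  -- the injective map Q ↦ line XQ
  let g : P → L := fun Q => if h : X = Q then l else HasLines.mkLine h
  have hg : ∀ Q ∈ Soff, X ∈ g Q ∧ Q ∈ g Q := by
    intro Q hQ
    have hQfix : σ.onPoints Q = Q := by
      have := (Finset.mem_filter.mp hQ).1; simpa [hS] using this
    have hXQ : X ≠ Q := fun h => hXnot (h ▸ hQfix)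
    simp only [g, dif_neg hXQ]
    exact HasLines.mkLine_ax (L := L) hXQ
  have hmaps : ∀ Q ∈ Soff, g Q ∈ LX := fun Q hQ => by simp [hLX, (hg Q hQ).1]
  have hinj : Set.InjOn g Soff := by
    intro Q hQ Q' hQ' heq
    by_contra hQQ'
    have hQfix : σ.onPoints Q = Q := by
      have := (Finset.mem_filter.mp hQ).1; simpa [hS] using this
    have hQ'fix : σ.onPoints Q' = Q' := by
      have := (Finset.mem_filter.mp hQ').1; simpa [hS] using this
    have hQl : Q ∉ l := (Finset.mem_filter.mp hQ).2
    obtain ⟨hXm, hQm⟩ := hg Q hQ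
    obtain ⟨-, hQ'm⟩ := hg Q' hQ'
    rw [← heq] at hQ'm
    -- the line g Q carries two fixed points Q ≠ Q', hence is fixed; X lies on it and on l
    have fm : σ.onLines (g Q) = g Q := σ.line_fixed_of_two_fixed hQm hQ'm hQQ' hQfix hQ'fix
    have hml : g Q ≠ l := fun h => hQl (h ▸ hQm)
    exact hXnot (σ.point_fixed_of_two_fixed hXm hXl hml fm hl)
  have hle : Soff.card ≤ LX.card := Finset.card_le_card_of_injOn g hmaps hinj
  rw [hSoff25, hLX13] at hle
  omega

/-- **Corollary.** No collineation of a projective plane of order 12 has order 7 (on points). -/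
theorem no_collineation_of_order_seven (h12 : ProjectivePlane.order P L = 12) :
    orderOf σ.onPoints ≠ 7 := by
  intro h7
  have hq : σ.onPoints ^ 7 = 1 := by rw [← h7]; exact pow_orderOf_eq_one σ.onPoints
  have h1 := σ.onPoints_eq_one_of_pow_seven h12 hq
  rw [h1, orderOf_one] at h7
  exact absurd h7 (by norm_num)

end Collineation

end Summit.Ventures.DiscreteObjects.PP12
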